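import Literature.Probability.RandomPlanarGeometry.ImageUnivalent
import HarnessLib

/-!
# Reparametrised discs and radial star domains: the disc-side carrier of the inner approximant
# (piece (K4a) of stub 5a4″ `stub_carvedReduction_squeezeSolid`)

Piece of stub 5a4″ `stub_carvedReduction_squeezeSolid`
(`TwoPieceAdmRestrictionLimit → MovingCarvingSqueezeP FatAnchoredClassZeroSolid`) of the line
`bridge-gate-renewal` (r11) of the crux `SAWDefectDecoherence.ObservableToSLER`
(stmt-CriticalPhenomena-14005; twin T-A `stub_carvedReduction_squeezeGeometry` of
stmt-CriticalPhenomena-10472), contract `InnerApproximant` (twin memo items 5–7).  The inner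
approximant `M'` of the limit bulk `Ω*` is built in the disc coordinates of a uniformizer
`ψ : 𝔻 → Ω*`: `M' = ψ̄ (U)` for a STAR DOMAIN `U = {z : ‖z‖ < r (z/‖z‖)}` (radial profile
`r ∈ [r_min, 1]`, equal to `1` exactly over the window arcs), with boundary loop
`t ↦ ψ̄ (r(e(Θ t)) e(Θ t))`, `e(θ) = e^{2πiθ}`, `Θ` a lift of the boundary correspondence of `D`.
This file supplies the disc-side data (structures are built inside proofs):
`exists_reparamDisc` — the unit disc with boundary loop `e ∘ Θ` for a continuous injective `Θ`
with `Θ (t + 1) = Θ t ± 1` and prescribed marks; the radial map `z ↦ r(z/‖z‖) · z`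
(`continuous_radial`, `radial_injective`, `image_radial_ball`, …), a homeomorphism of the closed
disc onto `{‖z‖ ≤ r(z/‖z‖)}`; `stub_carvedReduction_starImage` — for `h` continuous on the closed disc and
injective on `𝔻 ∪ {‖z‖ = 1, r z = 1}`, the Dobrushin domain with carrier `h '' U`, loop
`t ↦ h (r(e(Θ t)) e(Θ t))`, prescribed marks, and closure inside `h '' 𝔻 ∪ h '' {‖z‖ = 1, r z = 1}`
(`MarkedDomain.image`, invariance of domain; registered as `stub_carvedReduction_starImage`).  Source: Ch. Pommerenke, Boundary Behaviour of
Conformal Maps (1992), Thm. 2.6 ((i) ⇒ (ii)).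
-/

noncomputable section
open scoped Topology Real
open Filter Set Metric Function
open Literature.Probability.RandomPlanarGeometry
namespace Summit.CriticalPhenomena.SAWScalingLimit.Theorems.ObservableToSLER.Squeeze

/-! ### The unit loop `e(θ) = circleMap 0 1 (2πθ)` -/

/-- `‖e(θ)‖ = 1`. -/
theorem norm_circleMap_two_pi (θ : ℝ) : ‖circleMap 0 1 (2 * π * θ)‖ = 1 := by
  rw [norm_circleMap_zero, abs_one]

/-- `e(a) = e(b) ↔ a - b ∈ ℤ`. -/
theorem circleMap_two_pi_eq_iff {a b : ℝ} :
    circleMap 0 1 (2 * π * a) = circleMap 0 1 (2 * π * b) ↔ ∃ n : ℤ, a = b + n := by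
  rw [circleMap_eq_circleMap_iff 0 one_ne_zero]
  constructor
  · rintro ⟨n, hn⟩
    refine ⟨n, ?_⟩
    have h1 : ((2 * π * a : ℝ) : ℂ) = ((2 * π * b : ℝ) : ℂ) + n * (2 * π) := by
      have := congrArg (fun z : ℂ => z * (-Complex.I)) hn
      simp only [add_mul] at this
      have e1 : ∀ x : ℂ, x * Complex.I * -Complex.I = x := fun x => by
        rw [mul_assoc, mul_neg, Complex.I_mul_I, neg_neg, mul_one]
      rw [e1, e1, show (n : ℂ) * (2 * π * Complex.I) * -Complex.I = n * (2 * π) by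
        rw [mul_assoc, mul_assoc, mul_neg, mul_assoc, Complex.I_mul_I]; ring] at this
      exact this
    have h2 : (2 * π * a : ℝ) = 2 * π * b + n * (2 * π) := by exact_mod_cast h1
    have hπ : (0 : ℝ) < 2 * π := by positivity
    have : 2 * π * a = 2 * π * (b + n) := by rw [h2]; ring
    exact mul_left_cancel₀ hπ.ne' this
  · rintro ⟨n, rfl⟩
    refine ⟨n, ?_⟩
    push_cast
    ring

/-- `e(θ + n) = e(θ)` for an integer `n`. -/
theorem circleMap_two_pi_add_int (θ : ℝ) (n : ℤ) :
    circleMap 0 1 (2 * π * (θ + n)) = circleMap 0 1 (2 * π * θ) :=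
  circleMap_two_pi_eq_iff.2 ⟨n, rfl⟩

/-- Every unit vector is `e(θ)` for some `θ` in any window `[c, c + 1)`. -/
theorem exists_circleMap_two_pi_eq {z : ℂ} (hz : ‖z‖ = 1) (c : ℝ) :
    ∃ θ ∈ Ico c (c + 1), circleMap 0 1 (2 * π * θ) = z := by
  have hz' : z ∈ sphere (0 : ℂ) |(1 : ℝ)| := by simpa using hz
  rw [← range_circleMap, mem_range] at hz'
  obtain ⟨s, hs⟩ := hz'
  refine ⟨toIcoMod one_pos c (s / (2 * π)), toIcoMod_mem_Ico one_pos c _, ?_⟩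
  rw [← hs]
  have hπ : (2 : ℝ) * π ≠ 0 := by positivity
  obtain ⟨n, hn⟩ : ∃ n : ℤ, toIcoMod one_pos c (s / (2 * π)) = s / (2 * π) + n :=
    ⟨-toIcoDiv one_pos c (s / (2 * π)), by rw [toIcoMod, zsmul_one, Int.cast_neg]; ring⟩
  rw [hn, circleMap_two_pi_add_int, mul_div_cancel₀ _ hπ]

/-- The unit loop is continuous. -/
theorem continuous_circleMap_two_pi : Continuous fun θ : ℝ => circleMap 0 1 (2 * π * θ) := by
  fun_prop

/-! ### Lifts `Θ` of circle homeomorphisms: `Θ (t + 1) = Θ t ± 1` -/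

/-- A continuous injective `Θ : ℝ → ℝ` with `Θ (t + 1) = Θ t + σ`, `σ = ±1`, has
`|Θ s - Θ t| < 1` for `s, t` in one period `[0, 1)`, so `e ∘ Θ` is injective there. -/
theorem injOn_circleMap_comp_lift {Θ : ℝ → ℝ} {σ : ℝ} (hσ : σ = 1 ∨ σ = -1) (hc : Continuous Θ)
    (hi : Injective Θ) (hper : ∀ t, Θ (t + 1) = Θ t + σ) :
    InjOn (fun t => circleMap 0 1 (2 * π * Θ t)) (Ico 0 1) := by
  -- `|Θ s - Θ t| < 1` on one period
  have key : ∀ s ∈ Ico (0 : ℝ) 1, ∀ t ∈ Ico (0 : ℝ) 1, |Θ s - Θ t| < 1 := by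
    have aux : ∀ (f : ℝ → ℝ), StrictMono f → (∀ t, f (t + 1) = f t + 1) →
        ∀ s ∈ Ico (0 : ℝ) 1, ∀ t ∈ Ico (0 : ℝ) 1, |f s - f t| < 1 := by
      intro f hf hf1 s hs t ht
      rw [abs_sub_lt_iff]
      constructor
      · have h1 : f s < f (t + 1) := hf (by linarith [hs.2, ht.1])
        rw [hf1] at h1; linarith
      · have h1 : f t < f (s + 1) := hf (by linarith [ht.2, hs.1])
        rw [hf1] at h1; linarith
    rcases hc.strictMono_of_inj hi with hmono | hanti
    · have hσ1 : σ = 1 := by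
        rcases hσ with h | h
        · exact h
        · exfalso
          have := hmono (show (0 : ℝ) < 0 + 1 by norm_num)
          rw [hper, h] at this; linarith
      subst hσ1
      exact aux Θ hmono hper
    · have hσ1 : σ = -1 := by
        rcases hσ with h | h
        · exfalso
          have := hanti (show (0 : ℝ) < 0 + 1 by norm_num)
          rw [hper, h] at this; linarith
        · exact h
      subst hσ1
      intro s hs t ht
      have := aux (fun x => -Θ x) hanti.neg (fun x => by simp only [hper]; ring) s hs t ht
      rwa [neg_sub_neg, abs_sub_comm] at this
  intro s hs t ht hst
  obtain ⟨n, hn⟩ := circleMap_two_pi_eq_iff.1 hst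
  have h1 := key s hs t ht
  rw [hn, add_sub_cancel_left] at h1
  have hn0 : n = 0 := by
    have : |(n : ℝ)| < 1 := h1
    exact_mod_cast Int.abs_lt_one_iff.1 (by exact_mod_cast this)
  rw [hn0, Int.cast_zero, add_zero] at hn
  exact hi hn

/-- A continuous `Θ` with `Θ (t + 1) = Θ t + σ`, `σ = ±1`, is onto `ℝ`. -/
theorem surjective_lift {Θ : ℝ → ℝ} {σ : ℝ} (hσ : σ = 1 ∨ σ = -1) (hc : Continuous Θ)
    (hper : ∀ t, Θ (t + 1) = Θ t + σ) : Surjective Θ := by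
  have hint : ∀ (n : ℕ) (t : ℝ), Θ (t + n) = Θ t + n * σ := by
    intro n
    induction n with
    | zero => intro t; simp
    | succ k ih => intro t; push_cast; rw [← add_assoc, hper, ih]; ring
  intro y
  -- two parameters with values on both sides of `y`
  obtain ⟨t₁, t₂, h₁, h₂⟩ : ∃ t₁ t₂ : ℝ, Θ t₁ ≤ y ∧ y ≤ Θ t₂ := by
    obtain ⟨n, hn⟩ := exists_nat_gt |y - Θ 0|
    have hyn : |y - Θ 0| < n := hn
    have h0 := hint n (0 + (n : ℝ) * (-1 : ℝ))
    rw [show (0 : ℝ) + n * (-1 : ℝ) + n = 0 by ring] at h0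
    have h1 := hint n 0
    rw [abs_lt] at hyn
    rcases hσ with rfl | rfl
    · exact ⟨0 + (n : ℝ) * (-1 : ℝ), 0 + n, by linarith, by linarith⟩
    · exact ⟨0 + n, 0 + (n : ℝ) * (-1 : ℝ), by linarith, by linarith⟩
  obtain ⟨t, -, ht⟩ := intermediate_value_uIcc hc.continuousOn (mem_uIcc.2 (Or.inl ⟨h₁, h₂⟩))
  exact ⟨t, ht⟩

/-- **The reparametrised unit disc.**  For a continuous injective `Θ : ℝ → ℝ` with
`Θ (t + 1) = Θ t ± 1` and marks `mk`, there is a Dobrushin domain with carrier the unit disc,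
boundary loop `t ↦ e(Θ t)` and marks `mk`. -/
theorem exists_reparamDisc (Θ : ℝ → ℝ) (σ : ℝ) (hσ : σ = 1 ∨ σ = -1) (hc : Continuous Θ)
    (hi : Injective Θ) (hper : ∀ t, Θ (t + 1) = Θ t + σ) (mk : Fin 2 → ℝ) (hmk : StrictMono mk)
    (hmem : ∀ i, mk i ∈ Ico (0 : ℝ) 1) :
    ∃ U : DobrushinDomain, U.carrier = ball 0 1 ∧
      (∀ t, U.boundary t = circleMap 0 1 (2 * π * Θ t)) ∧ U.mark = mk := by
  refine ⟨{ carrier := ball 0 1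
            boundary := fun t => circleMap 0 1 (2 * π * Θ t)
            isOpen := isOpen_ball
            isBounded := isBounded_ball
            isConnected := ((convex_ball (0 : ℂ) 1).isPathConnected (by simp)).isConnected
            continuous_boundary := continuous_circleMap_two_pi.comp hc
            periodic_boundary := fun t => ?_
            injOn_boundary := injOn_circleMap_comp_lift hσ hc hi hper
            range_boundary := ?_
            mark := mk
            strictMono_mark := hmk
            mark_mem := hmem }, rfl, fun t => rfl, rfl⟩
  · show circleMap 0 1 (2 * π * Θ (t + 1)) = circleMap 0 1 (2 * π * Θ t)
    rw [hper]
    rcases hσ with rfl | rfl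
    · exact_mod_cast circleMap_two_pi_add_int (Θ t) 1
    · exact_mod_cast circleMap_two_pi_add_int (Θ t) (-1)
  · rw [frontier_ball _ one_ne_zero]
    refine (range_subset_iff.2 fun t => ?_).antisymm fun z hz => ?_
    · exact mem_sphere_zero_iff_norm.2 (norm_circleMap_two_pi (Θ t))
    · obtain ⟨θ, -, hθ⟩ := exists_circleMap_two_pi_eq (mem_sphere_zero_iff_norm.1 hz) 0
      obtain ⟨t, rfl⟩ := surjective_lift hσ hc hper θ
      exact ⟨t, hθ⟩

/-! ### The radial map `z ↦ r(z/‖z‖) · z` -/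

section Radial

variable {r : ℂ → ℝ} {rmin : ℝ}

/-- Positive rescaling does not change the direction. -/
theorem dir_smul {z : ℂ} {c : ℝ} (hc : 0 < c) : (‖c • z‖⁻¹ : ℝ) • (c • z) = (‖z‖⁻¹ : ℝ) • z := by
  rcases eq_or_ne z 0 with rfl | hz
  · simp
  · rw [norm_smul, Real.norm_eq_abs, abs_of_pos hc, smul_smul, mul_inv]
    congr 1
    field_simp

/-- The direction map is continuous away from the origin. -/
theorem continuousAt_dir {z : ℂ} (hz : z ≠ 0) : ContinuousAt (fun w : ℂ => (‖w‖⁻¹ : ℝ) • w) z :=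
  ((continuousAt_id.norm.inv₀ (norm_ne_zero_iff.2 hz)).smul continuousAt_id)

/-- `‖r(z/‖z‖) · z‖ = r(z/‖z‖) ‖z‖` for a nonnegative profile. -/
theorem norm_radial (hb : ∀ z, rmin ≤ r z ∧ r z ≤ 1) (hrmin : 0 < rmin) (z : ℂ) :
    ‖((r ((‖z‖⁻¹ : ℝ) • z) : ℝ) : ℂ) * z‖ = r ((‖z‖⁻¹ : ℝ) • z) * ‖z‖ := by
  rw [norm_mul, Complex.norm_real, Real.norm_eq_abs,
    abs_of_pos (hrmin.trans_le (hb _).1)]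

/-- The radial map is multiplication by a positive real scalar depending on the direction. -/
theorem radial_eq_smul (z : ℂ) :
    ((r ((‖z‖⁻¹ : ℝ) • z) : ℝ) : ℂ) * z = (r ((‖z‖⁻¹ : ℝ) • z)) • z :=
  (Complex.real_smul).symm

/-- The radial map preserves directions. -/
theorem dir_radial (hb : ∀ z, rmin ≤ r z ∧ r z ≤ 1) (hrmin : 0 < rmin) (z : ℂ) :
    (‖((r ((‖z‖⁻¹ : ℝ) • z) : ℝ) : ℂ) * z‖⁻¹ : ℝ) • (((r ((‖z‖⁻¹ : ℝ) • z) : ℝ) : ℂ) * z) =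
      (‖z‖⁻¹ : ℝ) • z := by
  rw [radial_eq_smul, dir_smul (hrmin.trans_le (hb _).1)]

/-- The radial map is continuous (the profile being continuous and bounded). -/
theorem continuous_radial (hr : Continuous r) (hb : ∀ z, rmin ≤ r z ∧ r z ≤ 1) (hrmin : 0 < rmin) :
    Continuous fun z : ℂ => ((r ((‖z‖⁻¹ : ℝ) • z) : ℝ) : ℂ) * z := by
  rw [continuous_iff_continuousAt]
  intro z
  rcases eq_or_ne z 0 with rfl | hz
  · -- at the origin: `‖F z‖ ≤ ‖z‖`
    rw [ContinuousAt, mul_zero]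
    refine squeeze_zero_norm (fun w => ?_) (continuous_norm.tendsto' (0 : ℂ) 0 norm_zero)
    rw [norm_radial hb hrmin]
    calc r ((‖w‖⁻¹ : ℝ) • w) * ‖w‖ ≤ 1 * ‖w‖ :=
          mul_le_mul_of_nonneg_right (hb _).2 (norm_nonneg _)
      _ = ‖w‖ := one_mul _
  · exact ((Complex.continuous_ofReal.continuousAt.comp
      (hr.continuousAt.comp (continuousAt_dir hz))).mul continuousAt_id)

/-- The radial map is injective. -/
theorem radial_injective (hb : ∀ z, rmin ≤ r z ∧ r z ≤ 1) (hrmin : 0 < rmin) :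
    Injective fun z : ℂ => ((r ((‖z‖⁻¹ : ℝ) • z) : ℝ) : ℂ) * z := by
  intro z w hzw
  have hzw' : ((r ((‖z‖⁻¹ : ℝ) • z) : ℝ) : ℂ) * z = ((r ((‖w‖⁻¹ : ℝ) • w) : ℝ) : ℂ) * w := hzw
  have hpos : ∀ u : ℂ, 0 < r u := fun u => hrmin.trans_le (hb u).1
  -- same direction
  have hdir : (‖z‖⁻¹ : ℝ) • z = (‖w‖⁻¹ : ℝ) • w := by
    have := congrArg (fun u : ℂ => (‖u‖⁻¹ : ℝ) • u) hzw'
    simpa only [dir_radial hb hrmin] using this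
  rw [hdir] at hzw'
  exact mul_left_cancel₀ (Complex.ofReal_ne_zero.2 (hpos _).ne') hzw'

/-- The radial map fixes the points whose direction has profile `1`. -/
theorem radial_eq_self {z : ℂ} (h : r ((‖z‖⁻¹ : ℝ) • z) = 1) :
    ((r ((‖z‖⁻¹ : ℝ) • z) : ℝ) : ℂ) * z = z := by
  rw [h, Complex.ofReal_one, one_mul]

/-- **The image of the unit disc is the star domain** `{w : ‖w‖ < r(w/‖w‖)}`. -/
theorem image_radial_ball (hb : ∀ z, rmin ≤ r z ∧ r z ≤ 1) (hrmin : 0 < rmin) :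
    (fun z : ℂ => ((r ((‖z‖⁻¹ : ℝ) • z) : ℝ) : ℂ) * z) '' ball 0 1 =
      {w : ℂ | ‖w‖ < r ((‖w‖⁻¹ : ℝ) • w)} := by
  have hpos : ∀ u : ℂ, 0 < r u := fun u => hrmin.trans_le (hb u).1
  ext w
  simp only [mem_image, mem_ball, dist_zero_right, mem_setOf_eq]
  constructor
  · rintro ⟨z, hz, rfl⟩
    rw [dir_radial hb hrmin, norm_radial hb hrmin]
    calc r ((‖z‖⁻¹ : ℝ) • z) * ‖z‖ < r ((‖z‖⁻¹ : ℝ) • z) * 1 :=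
          mul_lt_mul_of_pos_left hz (hpos _)
      _ = _ := mul_one _
  · intro hw
    refine ⟨((r ((‖w‖⁻¹ : ℝ) • w))⁻¹ : ℝ) • w, ?_, ?_⟩
    · rw [norm_smul, Real.norm_eq_abs, abs_of_pos (inv_pos.2 (hpos _)),
        inv_mul_lt_iff₀ (hpos _), mul_one]
      exact hw
    · show ((r ((‖((r ((‖w‖⁻¹ : ℝ) • w))⁻¹ : ℝ) • w‖⁻¹ : ℝ) •
          (((r ((‖w‖⁻¹ : ℝ) • w))⁻¹ : ℝ) • w)) : ℝ) : ℂ) * (((r ((‖w‖⁻¹ : ℝ) • w))⁻¹ : ℝ) • w) = w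
      rw [dir_smul (inv_pos.2 (hpos _))]
      set c : ℝ := r ((‖w‖⁻¹ : ℝ) • w) with hc
      have hcw : (c⁻¹ : ℝ) • w = ((c⁻¹ : ℝ) : ℂ) * w := Complex.real_smul
      rw [hcw, ← mul_assoc, ← Complex.ofReal_mul, mul_inv_cancel₀ (hpos _).ne',
        Complex.ofReal_one, one_mul]

/-- The radial map does not increase norms (`r ≤ 1`). -/
theorem norm_radial_le (hb : ∀ z, rmin ≤ r z ∧ r z ≤ 1) (hrmin : 0 < rmin) (z : ℂ) :
    ‖((r ((‖z‖⁻¹ : ℝ) • z) : ℝ) : ℂ) * z‖ ≤ ‖z‖ := by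
  rw [norm_radial hb hrmin]
  calc r ((‖z‖⁻¹ : ℝ) • z) * ‖z‖ ≤ 1 * ‖z‖ := mul_le_mul_of_nonneg_right (hb _).2 (norm_nonneg _)
    _ = ‖z‖ := one_mul _

/-- On the closed disc, the radial image has norm `1` exactly at the unit vectors of profile `1`. -/
theorem norm_radial_eq_one_iff (hb : ∀ z, rmin ≤ r z ∧ r z ≤ 1) (hrmin : 0 < rmin) {z : ℂ}
    (hz : ‖z‖ ≤ 1) : ‖((r ((‖z‖⁻¹ : ℝ) • z) : ℝ) : ℂ) * z‖ = 1 ↔ ‖z‖ = 1 ∧ r z = 1 := by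
  have hpos : ∀ u : ℂ, 0 < r u := fun u => hrmin.trans_le (hb u).1
  rw [norm_radial hb hrmin]
  constructor
  · intro h
    have h1 : ‖z‖ = 1 := by
      by_contra hne
      have hlt : ‖z‖ < 1 := lt_of_le_of_ne hz hne
      have : r ((‖z‖⁻¹ : ℝ) • z) * ‖z‖ < 1 * 1 :=
        mul_lt_mul' (hb _).2 hlt (norm_nonneg _) one_pos
      linarith
    refine ⟨h1, ?_⟩
    rw [h1, inv_one, one_smul, mul_one] at h
    exact h
  · rintro ⟨h1, h2⟩
    rw [h1, inv_one, one_smul, h2, mul_one]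

/-- The star domain contains the disc of radius `r_min` and lies in the unit disc. -/
theorem ball_subset_star_subset_ball (hb : ∀ z, rmin ≤ r z ∧ r z ≤ 1) :
    ball (0 : ℂ) rmin ⊆ {w : ℂ | ‖w‖ < r ((‖w‖⁻¹ : ℝ) • w)} ∧
      {w : ℂ | ‖w‖ < r ((‖w‖⁻¹ : ℝ) • w)} ⊆ ball 0 1 :=
  ⟨fun _ hw => (mem_ball_zero_iff.1 hw).trans_le (hb _).1,
    fun _ hw => mem_ball_zero_iff.2 (lt_of_lt_of_le hw (hb _).2)⟩

end Radial

/-! ### The image Dobrushin domain `h (U)` with the loop `t ↦ h (r(e(Θ t)) e(Θ t))` -/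

/-- **Registered sub-goal `stub_carvedReduction_starImage`** (crux item stmt-CriticalPhenomena-14005,
stub 5a4″ `stub_carvedReduction_squeezeSolid`, piece (K4a) THE STAR IMAGE).  Let `Θ` be a continuous injective lift (`Θ (t+1) = Θ t ± 1`), `mk` marks,
`r : ℂ → ℝ` a continuous profile with values in `[r_min, 1]` (`r_min > 0`), and `h : ℂ → ℂ`
continuous on the closed unit disc and injective on `𝔻 ∪ {‖z‖ = 1, r z = 1}`.  Then there is a
Dobrushin domain `M` with carrier `h '' {w : ‖w‖ < r(w/‖w‖)}`, boundary loop
`t ↦ h (r(e(Θ t)) · e(Θ t))`, marks `mk`, marked points `h (r(e(Θ (mk i))) · e(Θ (mk i)))`,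
contained with its closure in `h '' 𝔻 ∪ h '' {‖z‖ = 1, r z = 1}`. [cite: PommerenkeBBCM1992, Thm. 2.6] -/
theorem stub_carvedReduction_starImage :
    ∀ (Θ : ℝ → ℝ) (σ : ℝ), (σ = 1 ∨ σ = -1) → Continuous Θ → Injective Θ →
    (∀ t, Θ (t + 1) = Θ t + σ) → ∀ (mk : Fin 2 → ℝ), StrictMono mk → (∀ i, mk i ∈ Ico (0 : ℝ) 1) →
    ∀ (r : ℂ → ℝ) (rmin : ℝ), Continuous r → 0 < rmin → (∀ z, rmin ≤ r z ∧ r z ≤ 1) →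
    ∀ (h : ℂ → ℂ), ContinuousOn h (closedBall 0 1) →
    InjOn h (ball 0 1 ∪ {z : ℂ | ‖z‖ = 1 ∧ r z = 1}) →
    ∃ M : DobrushinDomain,
      M.carrier = h '' {w : ℂ | ‖w‖ < r ((‖w‖⁻¹ : ℝ) • w)} ∧
      (∀ t, M.boundary t = h (((r (circleMap 0 1 (2 * π * Θ t)) : ℝ) : ℂ) *
        circleMap 0 1 (2 * π * Θ t))) ∧
      M.mark = mk ∧
      (∀ i, M.pt i = h (((r (circleMap 0 1 (2 * π * Θ (mk i))) : ℝ) : ℂ) *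
        circleMap 0 1 (2 * π * Θ (mk i)))) ∧
      M.carrier ⊆ h '' ball 0 1 ∧
      closure M.carrier ⊆ h '' ball 0 1 ∪ h '' {z : ℂ | ‖z‖ = 1 ∧ r z = 1} := by
  intro Θ σ hσ hΘc hΘi hper mk hmk hmem r rmin hr hrmin hb h hhc hhi
  obtain ⟨U, hUc, hUb, hUm⟩ := exists_reparamDisc Θ σ hσ hΘc hΘi hper mk hmk hmem
  set F : ℂ → ℂ := fun z => ((r ((‖z‖⁻¹ : ℝ) • z) : ℝ) : ℂ) * z with hF
  have hFc : Continuous F := continuous_radial hr hb hrmin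
  have hFi : Injective F := radial_injective hb hrmin
  -- `F` maps the closed disc into `𝔻 ∪ {‖z‖ = 1, r z = 1}`
  have hFmaps : MapsTo F (closedBall 0 1) (ball 0 1 ∪ {z : ℂ | ‖z‖ = 1 ∧ r z = 1}) := by
    intro z hz
    rw [mem_closedBall, dist_zero_right] at hz
    have hle : ‖F z‖ ≤ 1 := (norm_radial_le hb hrmin z).trans hz
    rcases hle.lt_or_eq with hlt | heq
    · exact Or.inl (by rwa [mem_ball, dist_zero_right])
    · obtain ⟨h1, h2⟩ := (norm_radial_eq_one_iff hb hrmin hz).1 heq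
      right
      have hz1 : r ((‖z‖⁻¹ : ℝ) • z) = 1 := by rwa [h1, inv_one, one_smul]
      refine ⟨?_, ?_⟩
      · show ‖F z‖ = 1
        exact heq
      · show r (F z) = 1
        simp only [hF]
        rw [radial_eq_self hz1]
        exact h2
  have hcl : closure U.carrier = closedBall 0 1 := by rw [hUc, closure_ball _ one_ne_zero]
  have hcomp_c : ContinuousOn (h ∘ F) (closure U.carrier) := by
    rw [hcl]
    exact hhc.comp hFc.continuousOn fun z hz =>
      mem_closedBall_zero_iff.2 ((norm_radial_le hb hrmin z).trans (mem_closedBall_zero_iff.1 hz))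
  have hcomp_i : InjOn (h ∘ F) (closure U.carrier) := by
    rw [hcl]
    intro z hz w hw hzw
    exact hFi (hhi (hFmaps hz) (hFmaps hw) hzw)
  refine ⟨U.image (h ∘ F) hcomp_c hcomp_i, ?_, fun t => ?_, ?_, fun i => ?_, ?_, ?_⟩
  · rw [MarkedDomain.carrier_image, image_comp, hUc, image_radial_ball hb hrmin]
  · rw [MarkedDomain.boundary_image, Function.comp_apply, hUb]
    simp only [hF, Function.comp_apply]
    rw [show (‖circleMap 0 1 (2 * π * Θ t)‖⁻¹ : ℝ) • circleMap 0 1 (2 * π * Θ t) =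
      circleMap 0 1 (2 * π * Θ t) by rw [norm_circleMap_two_pi, inv_one, one_smul]]
  · rw [MarkedDomain.mark_image, hUm]
  · rw [MarkedDomain.pt_image]
    show (h ∘ F) (U.boundary (U.mark i)) = _
    rw [hUm, hUb, Function.comp_apply]
    simp only [hF]
    rw [show (‖circleMap 0 1 (2 * π * Θ (mk i))‖⁻¹ : ℝ) • circleMap 0 1 (2 * π * Θ (mk i)) =
      circleMap 0 1 (2 * π * Θ (mk i)) by rw [norm_circleMap_two_pi, inv_one, one_smul]]
  · rw [MarkedDomain.carrier_image, image_comp, hUc]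
    refine image_mono ?_
    rw [image_radial_ball hb hrmin]
    exact (ball_subset_star_subset_ball hb).2
  · rw [MarkedDomain.closure_carrier_image, hcl, image_comp]
    rintro _ ⟨w, ⟨z, hz, rfl⟩, rfl⟩
    rcases hFmaps hz with h1 | h2
    · exact Or.inl ⟨F z, h1, rfl⟩
    · exact Or.inr ⟨F z, h2, rfl⟩

end Summit.CriticalPhenomena.SAWScalingLimit.Theorems.ObservableToSLER.Squeeze

end
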